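import Summits.BirchSwinnertonDyer.BirchSwinnertonDyer.Theorems.KimAtThreeFineKatoTwoExpRouteLeaf
import HarnessLib

/-!
# Route `KimAtThreeKolyvagin` (W2): crux 19077 `ShallowEqDeepAtTorsionFree`, its children and the ROUTE LEAF BY NAME keyed on the
# ROUTE ITEM `KatoPeriodPositionThree` (stmt-BirchSwinnertonDyer-21401) (cell `bsd-addord`, seat w2-c4 gen 14; helper,
# `--supports stmt-BirchSwinnertonDyer-19077`)

HONEST FRAMING.  COMPOSITION THEOREMS ONLY (no definition, no named fact, no instance, no `sorry`).  The planner registered the W2 route's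
ONE displayed non-cite statement as the support item `Theses.KimAtThreeKolyvagin.KatoPeriodPositionThree` (route file rev 17,
2026-08-27T19:05Z; FORM A: its body is the single token
`Theorems.KimAtThreeShallowEqDeepPositionDefs.KatoPeriodPositionAtThree`, w2-c4 gen 13 p552920).  This file re-keys the by-name end forms
of record — w2-c4 gen 13 `KimAtThreeShallowEqDeepOfPeriodPosition` (p554491) and w2-acc3 gen 9 `KimAtThreeFineKatoTwoExpRouteLeaf` §2 —
on THAT ROUTE DECL, so that every displayed hypothesis of the W2 chain is either a ROUTE ITEM (the four held-PUB leaves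
`SakamotoKolyvaginThree` 19558 / `RankEqAnalyticRankLeOne` 19921 / `PoitouTateSelmerDuality` 19559 / `CarayolLevelEqConductor` 19467 and
the support item `KatoPeriodPositionThree` 21401) or a Literature cite fact ((S5a) `expStarCoord_eq_zero_iff_kummer`, (S5b-tower)
`exists_smul_range_expStarCoord_tower_iff_trace_log`, (P123) `cupLogInjective_and_hasDualExp_of_isDeRham`, (DR)
`isDeRham_restrictedRationalTateRep`; for the leaf also Kato's `Kato2004.exists_eulerSystem_definedExpStar_values`).
`KatoPeriodPositionThree` is the route's OWN hypothesis — STRONGER than Kato's theorem (the Literature matrix has no position conjunct),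
print status PRE, TRUE on paper for Kato's datum (KIM3-POS-g16 Thm A; W2C4-POSITION-g13 §1) but not kernel-typable today; refuters may
attack it as ¬POS.  EVERYTHING HERE IS CONDITIONAL on the displayed hypotheses; nothing is closed or booked by this file; BSD is NOT
proved by any of this («closes rung W2 of BirchSwinnertonDyer» only modulo the displayed hypotheses — never summit credit).

WHAT.
* `katoPeriodPositionThree_iff` — AUDIT: the route item unfolds to the Defs statement (`Iff.rfl`).
* crux 19560 `KatoKuriharaPortThreeShared`, items 20275 `DefinedKatoWeightedNonAdditiveThree`, 20397 `FineKatoTauAnomalousThree`,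
  20398 `FineKatoTwoExpDefectThree` BY NAME ⟸ the four cites ∧ `KatoPeriodPositionThree`;
* crux 19599 `ShallowEqDeepOffKatoStratum` BY NAME ⟸ three route leaves ∧ the four cites ∧ `KatoPeriodPositionThree`;
* **crux 19077 `ShallowEqDeepAtTorsionFree` BY NAME ⟸ the four route leaves ∧ the four cites ∧ `KatoPeriodPositionThree`** — i.e.
  FIVE ROUTE ITEMS ∧ FOUR Literature cite facts, nothing else (`shallowEqDeepAtTorsionFree_of_katoPeriodPositionThree_of_cites`);
* the ROUTE LEAF `N11.KimAtThreeRankZeroPUB` BY NAME ⟸ the same ∧ the Kato Literature fact.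
READING (08-28, W2): the route's displayed NON-CITE residual is exactly ONE route item, `KatoPeriodPositionThree` (21401).
Credit: w2-c4 g12/g13 and w2-acc3 g9 (the end forms), kim3 / w2-acc4 / w2-acc5 / w2-kport / w2-c2 / w2-c3 / n1011 (everything underneath).
References: [Kim2025RefinedTNC] Thm. 1.1/1.2; [Kato2004Asterisque] (8.1.3), 8.12, §9.4, 9.7, 6.6 (1), 13.3; [Kato1993LNM1553] II
§1.2.4, 1.2.3, 1.4.1; [BlochKato1990] §3; [Kim2022StructureSelmer] Lemma 3.4, Cor. 3.5, Lemma 3.10, Thm. 3.13; [Sakamoto2024] Thm. 4.4;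
[MazurRubin2004] Thm. 4.4.1, 5.2.12; [Carayol1986].
-/

set_option autoImplicit false

noncomputable section

-- the cell's Theorems namespace `Summit.BirchSwinnertonDyer.BirchSwinnertonDyer.…` repeats the summit name by design (D-0017)
set_option linter.dupNamespace false

open Literature.NumberTheory.PAdicHodge Literature.NumberTheory.EllipticCurves
open Summit.BirchSwinnertonDyer.BirchSwinnertonDyer.Theses.KimAtThreeKolyvagin
open Summit.BirchSwinnertonDyer.BirchSwinnertonDyer.Theorems.KimAtThreeShallowEqDeepOfPeriodPosition
open Summit.BirchSwinnertonDyer.BirchSwinnertonDyer.Theorems.KimAtThreeFineKatoTwoExpRouteLeaf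

namespace Summit.BirchSwinnertonDyer.BirchSwinnertonDyer.Theorems.KimAtThreeShallowEqDeepOfPeriodPositionItem

/-- **AUDIT.** The route item `KatoPeriodPositionThree` (stmt-BirchSwinnertonDyer-21401, FORM A) IS the Defs statement
`KimAtThreeShallowEqDeepPositionDefs.KatoPeriodPositionAtThree` (w2-c4 gen 13, p552920): `Iff.rfl`.  Nothing asserted about either side. -/
theorem katoPeriodPositionThree_iff :
    KatoPeriodPositionThree ↔
      Summit.BirchSwinnertonDyer.BirchSwinnertonDyer.Theorems.KimAtThreeShallowEqDeepPositionDefs.KatoPeriodPositionAtThree :=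
  Iff.rfl

/-- **Crux 19560 `KatoKuriharaPortThreeShared` BY NAME ⟸ the route item `KatoPeriodPositionThree` ∧ the four cites {(P123), (DR), (S5a),
(S5b-tower)}** (w2-c4 gen 13's `katoKuriharaPortThreeShared_of_periodPosition_of_cites`, = w2-acc4's
`katoKuriharaPortThreeShared_of_facts_of_katoPos` at the Kato-stratum rows).  CONDITIONAL; nothing booked; 19560 stays OPEN.
[cite: Kato2004Asterisque, §9.4 (p. 188), Thm. 9.7 (p. 189), Ex. 13.3 (pp. 224–225)] [cite: BlochKato1990, §3 Prop. 3.8, Ex. 3.11]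
[cite: Kim2022StructureSelmer, Lemma 3.4, Cor. 3.5, Thm. 3.13] -/
theorem katoKuriharaPortThreeShared_of_katoPeriodPositionThree_of_cites (hPos : KatoPeriodPositionThree)
    (hP : cupLogInjective_and_hasDualExp_of_isDeRham) (hDR : isDeRham_restrictedRationalTateRep)
    (hS : expStarCoord_eq_zero_iff_kummer) (hT₂ : exists_smul_range_expStarCoord_tower_iff_trace_log) :
    KatoKuriharaPortThreeShared :=
  katoKuriharaPortThreeShared_of_periodPosition_of_cites hPos hP hDR hS hT₂

/-- **Item 20275 `DefinedKatoWeightedNonAdditiveThree` BY NAME ⟸ the route item `KatoPeriodPositionThree` ∧ the four cites** (w2-c4 gen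
13's `definedKatoWeightedNonAdditiveThree_of_periodPosition_of_cites`).  CONDITIONAL; nothing booked.
[cite: Kato2004Asterisque, (8.1.3) (p. 180), §9.4 (p. 188), Thm. 9.7 (p. 189), Thm. 16.6.2, Ex. 13.3 (pp. 224–225)]
[cite: BlochKato1990, §3 Prop. 3.8, Ex. 3.11] -/
theorem definedKatoWeightedNonAdditiveThree_of_katoPeriodPositionThree_of_cites (hPos : KatoPeriodPositionThree)
    (hP : cupLogInjective_and_hasDualExp_of_isDeRham) (hDR : isDeRham_restrictedRationalTateRep)
    (hS : expStarCoord_eq_zero_iff_kummer) (hT₂ : exists_smul_range_expStarCoord_tower_iff_trace_log) :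
    DefinedKatoWeightedNonAdditiveThree :=
  definedKatoWeightedNonAdditiveThree_of_periodPosition_of_cites hPos hP hDR hS hT₂

/-- **Item 20397 `FineKatoTauAnomalousThree` BY NAME ⟸ the route item `KatoPeriodPositionThree` ∧ the four cites** (w2-c4 gen 13's
`fineKatoTauAnomalousThree_of_periodPosition_of_cites`).  CONDITIONAL; nothing booked.
[cite: Kato2004Asterisque, (8.1.3) (p. 180), §9.4 (p. 188), Thm. 9.7 (p. 189), Ex. 13.3 (pp. 224–225)]
[cite: BlochKato1990, §3 Prop. 3.8, Ex. 3.11] [cite: Kim2022StructureSelmer, Lemma 3.4, Cor. 3.5, Thm. 3.13] -/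
theorem fineKatoTauAnomalousThree_of_katoPeriodPositionThree_of_cites (hPos : KatoPeriodPositionThree)
    (hP : cupLogInjective_and_hasDualExp_of_isDeRham) (hDR : isDeRham_restrictedRationalTateRep)
    (hS : expStarCoord_eq_zero_iff_kummer) (hT₂ : exists_smul_range_expStarCoord_tower_iff_trace_log) :
    FineKatoTauAnomalousThree :=
  fineKatoTauAnomalousThree_of_periodPosition_of_cites hPos hP hDR hS hT₂

/-- **Item 20398 `FineKatoTwoExpDefectThree` BY NAME ⟸ the route item `KatoPeriodPositionThree` ∧ the four cites** (w2-acc3 gen 9's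
`fineKatoTwoExpDefectThree_of_periodPosition_of_cites` = its `fineKatoTwoExpDefectThree_of_facts_of_katoPosW` ∘ w2-c4 gen 13's
`katoPosW_of_periodPosition_of_facts`).  CONDITIONAL; nothing booked; 20398 stays OPEN.
[cite: Kato2004Asterisque, (8.1.3) (p. 180), Prop. 8.12 (p. 186), §9.4 and Thm. 9.7 (pp. 188–189), Thm. 6.6 (1) (p. 163), Ex. 13.3 (pp. 224–225)]
[cite: Kato1993LNM1553, Ch. II §1.2.4, Prop. 1.2.3 and Thm. 1.4.1] [cite: BlochKato1990, §3 Prop. 3.8, Ex. 3.11]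
[cite: Kim2022StructureSelmer, §3.2.3, Lemma 3.10, §3.3–§3.4.1 and Thm. 3.13] -/
theorem fineKatoTwoExpDefectThree_of_katoPeriodPositionThree_of_cites (hPos : KatoPeriodPositionThree)
    (hP : cupLogInjective_and_hasDualExp_of_isDeRham) (hDR : isDeRham_restrictedRationalTateRep)
    (hS : expStarCoord_eq_zero_iff_kummer) (hT₂ : exists_smul_range_expStarCoord_tower_iff_trace_log) :
    FineKatoTwoExpDefectThree :=
  fineKatoTwoExpDefectThree_of_periodPosition_of_cites hPos hP hDR hS hT₂

/-- **Crux 19599 `ShallowEqDeepOffKatoStratum` BY NAME ⟸ the three route leaves `SakamotoKolyvaginThree` ∧ `RankEqAnalyticRankLeOne` ∧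
`PoitouTateSelmerDuality` ∧ the four cites ∧ the route item `KatoPeriodPositionThree`** — FOUR ROUTE ITEMS ∧ four Literature cite facts,
nothing else (w2-acc3 gen 9's `shallowEqDeepOffKatoStratum_of_periodPosition_of_cites'`; item 20398 discharged inside).  CONDITIONAL;
nothing booked; 19599 stays OPEN.
[cite: Kim2025RefinedTNC, Thm 1.2] [cite: Sakamoto2024, Thm. 4.4 (p. 926)] [cite: MazurRubin2004, Thm. 4.4.1 and Thm. 5.2.12]
[cite: Kato2004Asterisque, (8.1.3) (p. 180), Prop. 8.12 (p. 186), §9.4 and Thm. 9.7 (pp. 188–189), Thm. 6.6 (1) (p. 163), Ex. 13.3 (pp. 224–225)]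
[cite: Kato1993LNM1553, Ch. II §1.2.4, Prop. 1.2.3 and Thm. 1.4.1] [cite: BlochKato1990, §3 Prop. 3.8, Ex. 3.11] -/
theorem shallowEqDeepOffKatoStratum_of_katoPeriodPositionThree_of_cites (hPos : KatoPeriodPositionThree)
    (hSak : SakamotoKolyvaginThree) (hGZK : RankEqAnalyticRankLeOne) (hPT : PoitouTateSelmerDuality)
    (hP : cupLogInjective_and_hasDualExp_of_isDeRham) (hDR : isDeRham_restrictedRationalTateRep)
    (hS : expStarCoord_eq_zero_iff_kummer) (hT₂ : exists_smul_range_expStarCoord_tower_iff_trace_log) :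
    ShallowEqDeepOffKatoStratum :=
  shallowEqDeepOffKatoStratum_of_periodPosition_of_cites' hPos hSak hGZK hPT hP hDR hS hT₂

/-- **Crux 19077 `ShallowEqDeepAtTorsionFree` BY NAME ⟸ the four route leaves `SakamotoKolyvaginThree` ∧ `RankEqAnalyticRankLeOne` ∧
`PoitouTateSelmerDuality` ∧ `CarayolLevelEqConductor` ∧ the four cites {(P123), (DR), (S5a), (S5b-tower)} ∧ the route item
`KatoPeriodPositionThree`** — FIVE ROUTE ITEMS ∧ four Literature cite facts, NOTHING ELSE (w2-acc3 gen 9's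
`shallowEqDeepAtTorsionFree_of_periodPosition_of_cites'` = w2-c4 gen 13's `shallowEqDeepAtTorsionFree_of_periodPosition_of_cites` with item
20398 discharged; 19560 discharged inside by w2-acc4's port theorem).  CONDITIONAL on every displayed hypothesis; nothing booked; 19077
stays OPEN (it closes only when the five items and the four cites have `_holds`).
[cite: Kim2025RefinedTNC, Thm 1.2] [cite: Sakamoto2024, Thm. 4.4 (p. 926)] [cite: MazurRubin2004, Thm. 4.4.1 and Thm. 5.2.12]
[cite: Kato2004Asterisque, (8.1.3) (p. 180), Prop. 8.12 (p. 186), §9.4 and Thm. 9.7 (pp. 188–189), Thm. 6.6 (1) (p. 163), Ex. 13.3 (pp. 224–225)]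
[cite: Kato1993LNM1553, Ch. II §1.2.4, Prop. 1.2.3 and Thm. 1.4.1] [cite: BlochKato1990, §3 Prop. 3.8, Ex. 3.11] [cite: Carayol1986] -/
theorem shallowEqDeepAtTorsionFree_of_katoPeriodPositionThree_of_cites (hPos : KatoPeriodPositionThree)
    (hSak : SakamotoKolyvaginThree) (hGZK : RankEqAnalyticRankLeOne) (hPT : PoitouTateSelmerDuality)
    (hlev : CarayolLevelEqConductor)
    (hP : cupLogInjective_and_hasDualExp_of_isDeRham) (hDR : isDeRham_restrictedRationalTateRep)
    (hS : expStarCoord_eq_zero_iff_kummer) (hT₂ : exists_smul_range_expStarCoord_tower_iff_trace_log) :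
    ShallowEqDeepAtTorsionFree :=
  shallowEqDeepAtTorsionFree_of_periodPosition_of_cites' hPos hSak hGZK hPT hlev hP hDR hS hT₂

/-- **The W2 ROUTE LEAF `N11.KimAtThreeRankZeroPUB` BY NAME ⟸ the four route leaves ∧ the four cites ∧ the Kato Literature fact
`Kato2004.exists_eulerSystem_definedExpStar_values` ∧ the route item `KatoPeriodPositionThree`** — every hypothesis a route item or a
Literature fact (w2-acc3 gen 9's `kimAtThreeRankZeroPUB_of_periodPosition_of_lit_of_cites'`; = the route's `closes` on w2-c2 / w2-c3's
cite-only deep cruxes, the 19077 theorem above and kim3's assembly).  CONDITIONAL on every displayed hypothesis; closes the rung-W2 leaf only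
modulo them; BSD is NOT proved by this.
[cite: Kim2025RefinedTNC, Thm 1.1, Thm 1.2] [cite: Kato2004Asterisque, (8.1.3) (p. 180), Prop. 8.12 (p. 186), §9.4 and Thm. 9.7 (pp. 188–189), Thm. 6.6 (1) (p. 163), Ex. 13.3 (pp. 224–225)]
[cite: Kato1993LNM1553, Ch. II §1.2.4, Prop. 1.2.3 and Thm. 1.4.1] [cite: BlochKato1990, §3 Prop. 3.8, Ex. 3.11]
[cite: Sakamoto2024, Thm. 4.4 (p. 926)] [cite: MazurRubin2004, Thm. 4.4.1 and Thm. 5.2.12] [cite: Carayol1986] -/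
theorem kimAtThreeRankZeroPUB_of_katoPeriodPositionThree_of_lit_of_cites (hPos : KatoPeriodPositionThree)
    (hLit : Kato2004.exists_eulerSystem_definedExpStar_values)
    (hSak : SakamotoKolyvaginThree) (hGZK : RankEqAnalyticRankLeOne) (hPT : PoitouTateSelmerDuality)
    (hlev : CarayolLevelEqConductor)
    (hP : cupLogInjective_and_hasDualExp_of_isDeRham) (hDR : isDeRham_restrictedRationalTateRep)
    (hS : expStarCoord_eq_zero_iff_kummer) (hT₂ : exists_smul_range_expStarCoord_tower_iff_trace_log) :
    Summit.BirchSwinnertonDyer.Rank1Residual.Additive.N11.KimAtThreeRankZeroPUB :=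
  kimAtThreeRankZeroPUB_of_periodPosition_of_lit_of_cites' hPos hLit hSak hGZK hPT hlev hP hDR hS hT₂

/-- **All-items form of crux 19077**: `ShallowEqDeepAtTorsionFree` from the route's held-PUB ALIAS `KatoStratumSharedParts` (item 19678:
Sakamoto ×2 ∧ GZK ∧ Poitou–Tate ∧ Carayol ∧ PORT″ — only its first four conjuncts are used) ∧ the route item `KatoPeriodPositionThree` ∧ the
four cites.  A convenience spelling for consumers that carry the alias; CONDITIONAL; nothing booked.
[cite: Kim2025RefinedTNC, Thm 1.2] [cite: Kato2004Asterisque, §9.4 and Thm. 9.7 (pp. 188–189), Ex. 13.3 (pp. 224–225)]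
[cite: BlochKato1990, §3 Prop. 3.8, Ex. 3.11] -/
theorem shallowEqDeepAtTorsionFree_of_sharedParts_of_katoPeriodPositionThree_of_cites (hParts : KatoStratumSharedParts)
    (hPos : KatoPeriodPositionThree)
    (hP : cupLogInjective_and_hasDualExp_of_isDeRham) (hDR : isDeRham_restrictedRationalTateRep)
    (hS : expStarCoord_eq_zero_iff_kummer) (hT₂ : exists_smul_range_expStarCoord_tower_iff_trace_log) :
    ShallowEqDeepAtTorsionFree :=
  shallowEqDeepAtTorsionFree_of_katoPeriodPositionThree_of_cites hPos hParts.1 hParts.2.1 hParts.2.2.1 hParts.2.2.2.1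
    hP hDR hS hT₂

end Summit.BirchSwinnertonDyer.BirchSwinnertonDyer.Theorems.KimAtThreeShallowEqDeepOfPeriodPositionItem

end
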